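import Mathlib
import Literature.Computability.Complexity.GateElimination
import Literature.Computability.Complexity.CircuitClassesProofs
import Literature.Computability.MetaComplexity.ProbabilisticCircuitSensitivityBounds
import HarnessLib

/-!
# `MCSP[θ]` is sensitive at EVERY truth-table position, hence needs `N − 1` deterministic and
# `N − O(1)` probabilistic `B₂` gates (folklore, kernel-checked; census row R10, known column)

Folklore, fully proved (no named facts). The companion file
`ProbabilisticCircuitSensitivityBounds.lean` proves that a probabilistic `B₂` circuit (error `≤ ε` on
every input) for a function with `m` somewhere-sensitive coordinates has `≥ (1 − 2ε)·m − 1` gates in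
its support, and bounds the number of NOWHERE-sensitive coordinates of `MCSP[θ]` by `log₂` of the
circuit count, whence `MCSP[θ] ∉ PSIZEae (N^{−c}) (N − ⌈N^{β'}⌉)` for `β' > max(β, 1 − c)` when
`θ n ≤ 2^{βn}`. This file removes the counting loss altogether by a SYMMETRY of the problem:

* **XOR-shift invariance of circuit size** (`Circuit.xorInputs`, `Circuit.eval_xorInputs`,
  `circuitSizeOver_B2_compXor_le`): for `a ∈ {0,1}ⁿ` the translate `g ∘ τ_a`, `τ_a(w) = w ⊕ a`, of
  a Boolean function `g` has `B₂`-circuit complexity `≤ max(C(g), 1)` — absorb the negations of the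
  shifted input variables into the gates reading them (a `B₂` gate with some inputs negated is a `B₂`
  gate); the `max(·, 1)` covers a gate-free circuit `g = w_k` with `a_k = 1`, where `¬w_k` costs one
  gate. Hence for `θ n ≥ 1` membership of a truth table in `MCSP[θ]` is invariant under the
  translation group of `{0,1}ⁿ` acting on table positions (`truthTable_compXor_mem_MCSPSize_iff`)
  (Lamagna–Savage-type bookkeeping; the symmetry itself is the `⊕`-part of the standard
  "`MCSP` is invariant under the affine group of the cube" remark).
* **Everywhere sensitivity** (`MCSPSize_sensitive_everywhere`): the translation group is transitive
  on positions, so if the slice `MCSP[θ] ∩ {0,1}^N` (`N = 2ⁿ`) is neither empty nor everything and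
  `θ n ≥ 1`, then EVERY position `i < N` has a boundary pair `x, x^i` (one sensitive position exists
  on any flip path from a YES to a NO table, `apply_flipBlock_eq_of_subset`; translate it).
* **Deterministic consequence** (`Circuit.le_size_succ_of_forall_sensitive`,
  `MCSPSize_not_mem_SIZEae_of_sensitive`, `MCSPSize_not_mem_SIZEae_sub_two`): a `B₂` circuit computing
  a function sensitive at all `N` coordinates has all of them in its light cone, so `≥ N − 1` gates
  (Hirsch–Melanich–Nikolenko 2012, Prop. 8.1, after Lamagna–Savage 1973: *"Suppose that f depends
  non-idly on each of its n variables … Then C(f) ≥ n − 1"*; here via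
  `Circuit.card_lightCone_le_size_succ`). Hence **`MCSP[θ] ∉ SIZEae (N − 2)`** for every `θ` with
  `1 ≤ θ n ≤ 2^{βn}` eventually (`β < 1`) — the row's `θ = ⌊n^β⌋` included. Chen–Li–Yang (CCC 2022,
  p. 7 L19–20) leave `2N − o(N)` open *"even against deterministic circuits"*; the kernel-checked
  deterministic known bound is now exactly the folklore `N − 1`.
* **Probabilistic consequence** (`PMF.card_sub_le_of_forall_sensitive`,
  `MCSPSize_not_mem_PSIZEae_of_sensitive`, `MCSPSize_not_mem_PSIZEae_sub_three`,
  `MCSPSize_not_mem_PSIZEae_sublinear'`): with all `N` coordinates sensitive the companion file's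
  averaging gives `N − (s + 1) ≤ 2εN` for any distribution of `s`-gate `B₂` circuits with error `≤ ε`,
  so **`MCSP[θ] ∉ PSIZEae (N^{−c}) (N − 3)` for every `c > 1`** and
  **`MCSP[θ] ∉ PSIZEae (N^{−c}) (N − ⌈N^{β'}⌉)` for every `β'` with `max(0, 1 − c) < β' < 1`** (the
  coupling `β < β'` of the companion file is gone: the deficiency now only pays for the error).
  NEEDED (R10, `ChenLiYang2022.Hypothesis16 β`): `∉ PSIZEae (N^{−c}) (2N + C·N/log log N)` for all
  `c > 0`, `C`. Known leading constant `1` (deficiency `2N^{1−c} + O(1)`), needed `2`.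

Rendering notes. (i) `Circuit.xorInputs` is `Circuit.mapGates` with the gate map
`Gate.xorInputs a` (same arity and wiring, truth table precomposed with the shift bits of its input
wires), so size and every arity-defined basis (`B2`) are preserved literally. (ii) The YES witness is
the constant function (one constant gate, so `θ n ≥ 1` is used twice: for the witness and for the
`max(·, 1)`); the NO witness comes from the tree's circuit count at `θ n ≤ 2^{βn}`, `β < 1`
(`exists_lt_circuitSizeOver_of_count_lt`, `eventually_exists_noBound_lt_circuitSizeOver`). (iii) No
threshold is minted: `N − 2`, `N − 3` are what the count gives (`N ≤ s + 1`, resp. `N − (s+1) ≤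
2N^{1−c} < 2`), stated next to the general family forms from which any other budget is read off.
(iv) As in the companion file the device needs EXACT thresholds (gap versions have no boundary
pairs) and is recorded as a THEOREM because print has no statement of it for `MCSP` (census
FRESHNESS §typer1-g10; CLY p. 7).

References: [cite: HirschMelanichNikolenko2012, Prop. 8.1 (p. 6 of the held text: C(f) ≥ n − 1 for
f depending on all variables; after Lamagna–Savage)]; [cite: ChenLiYang2022, Thm. 1.6 (p. 7), p. 7
L19–20 (open problem), §2.2]; [cite: Jukna2012, §1.2 (B₂, size)]; [cite: BravyiGossetKonigScience2018,
§2 Eq. (5) (light cones)]; [cite: AroraBarak2009, Thm. 6.21 (counting)].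
-/

namespace Literature.Computability.Complexity

open Finset
open scoped ENNReal

universe u

section XorShift

variable {ι : Type u}

/-! ### XOR-shifting the inputs of a circuit -/

/-- The shift bit carried by a wire: `a i` on the input wire `i`, nothing on a gate wire.
[cite: Jukna2012, §1.2 (B₂ = all gates of fan-in ≤ 2; input negations absorbed into gates)] -/
def wireShift (a : ι → Bool) : ι ⊕ ℕ → Bool
  | .inl i => a i
  | .inr _ => false

/-- Reading a wire and then adding its shift bit is reading the wire on the shifted input.
[cite: Jukna2012, §1.2 (B₂ = all gates of fan-in ≤ 2; input negations absorbed into gates)] -/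
theorem xor_wireVal_wireShift (x a : ι → Bool) (vals : List Bool) :
    ∀ w : ι ⊕ ℕ, xor (wireVal x vals w) (wireShift a w) = wireVal (fun i => xor (x i) (a i)) vals w
  | .inl _ => rfl
  | .inr _ => Bool.xor_false _

/-- The gate `g` with the shift bits `a` of its input wires absorbed into its truth table (same
arity, same wiring). [cite: Jukna2012, §1.2 (B₂ = all gates of fan-in ≤ 2; input negations absorbed into gates)] -/
def Gate.xorInputs (a : ι → Bool) (g : Gate ι) : Gate ι where
  arity := g.arity
  op w := g.op fun k => xor (w k) (wireShift a (g.args k))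
  args := g.args

/-- The absorbed gate has the same arity. [cite: Jukna2012, §1.2 (B₂ = all gates of fan-in ≤ 2; input negations absorbed into gates)] -/
@[simp] theorem Gate.xorInputs_arity (a : ι → Bool) (g : Gate ι) : (g.xorInputs a).arity = g.arity :=
  rfl

/-- The absorbed gate computes, on input `x`, what `g` computes on the shifted input `x ⊕ a`.
[cite: Jukna2012, §1.2 (B₂ = all gates of fan-in ≤ 2; input negations absorbed into gates)] -/
theorem Gate.gateValue_xorInputs (x a : ι → Bool) (vals : List Bool) (g : Gate ι) :
    gateValue x vals (g.xorInputs a) = gateValue (fun i => xor (x i) (a i)) vals g := by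
  simp only [gateValue, Gate.xorInputs, xor_wireVal_wireShift]

/-- Transcripts: absorbing the shift into every gate = running the gates on the shifted input.
[cite: Jukna2012, §1.2 (B₂ = all gates of fan-in ≤ 2; input negations absorbed into gates)] -/
theorem transcript_map_xorInputs (x a : ι → Bool) :
    ∀ (gs : List (Gate ι)) (vals : List Bool),
      transcript x vals (gs.map (Gate.xorInputs a)) = transcript (fun i => xor (x i) (a i)) vals gs
  | [], _ => rfl
  | g :: gs, vals => by
    rw [List.map_cons, transcript_cons, transcript_cons, Gate.gateValue_xorInputs]
    exact transcript_map_xorInputs x a gs _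

namespace Circuit

/-- The circuit `C` with the shift `a` absorbed into its gates (`Circuit.mapGates`; same size, same
output wire). [cite: Jukna2012, §1.2 (B₂ = all gates of fan-in ≤ 2; input negations absorbed into gates)] -/
def xorInputs (C : Circuit ι) (a : ι → Bool) : Circuit ι :=
  C.mapGates (Gate.xorInputs a) fun _ k _ hk => ⟨k, hk⟩

/-- Absorbing a shift preserves the number of gates. [cite: Jukna2012, §1.2 (B₂ = all gates of fan-in ≤ 2; input negations absorbed into gates)] -/
@[simp] theorem size_xorInputs (C : Circuit ι) (a : ι → Bool) : (C.xorInputs a).size = C.size :=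
  List.length_map ..

/-- Absorbing a shift preserves being a `B₂` circuit (the basis is defined by arity).
[cite: Jukna2012, §1.2 (B₂ = all gates of fan-in ≤ 2; input negations absorbed into gates)] -/
theorem isOver_B2_xorInputs {C : Circuit ι} (hC : C.IsOver B2) (a : ι → Bool) :
    (C.xorInputs a).IsOver B2 := by
  intro g hg
  obtain ⟨g₀, hg₀, rfl⟩ := List.mem_map.1 hg
  exact hC g₀ hg₀

/-- If the output wire is a gate, the shifted circuit computes `x ↦ C(x ⊕ a)`.
[cite: Jukna2012, §1.2 (B₂ = all gates of fan-in ≤ 2; input negations absorbed into gates)] -/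
theorem eval_xorInputs (C : Circuit ι) (a : ι → Bool) {m : ℕ} (hm : C.output = .inr m)
    (x : ι → Bool) : (C.xorInputs a).eval x = C.eval fun i => xor (x i) (a i) := by
  rw [eval_eq_wireVal, eval_eq_wireVal]
  change wireVal x (transcript x [] (C.gates.map (Gate.xorInputs a))) C.output = _
  rw [transcript_map_xorInputs, hm]
  rfl

/-- The one-gate circuit `¬x_i`. [cite: Vollmer1999, §1.1] -/
def notInput (i : ι) : Circuit ι where
  gates := [⟨1, fun v => !(v 0), fun _ => .inl i⟩]
  output := .inr 0
  wf j h a _ ha := by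
    simp only [List.length_singleton, Nat.lt_one_iff] at h
    subst h
    exact absurd ha Sum.inl_ne_inr
  wf_output m h := by cases h; simp

/-- `notInput i` computes `¬x_i`. [cite: Vollmer1999, §1.1] -/
@[simp] theorem eval_notInput (i : ι) (x : ι → Bool) : (notInput i).eval x = !x i := rfl

/-- `notInput i` has one gate. [cite: Vollmer1999, §1.1] -/
@[simp] theorem size_notInput (i : ι) : (notInput i : Circuit ι).size = 1 := rfl

/-- `notInput i` is a `B₂` circuit. [cite: Jukna2012, §1.2 (B₂)] -/
theorem isOver_B2_notInput (i : ι) : (notInput i : Circuit ι).IsOver B2 := by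
  intro g hg
  simp only [notInput, List.mem_singleton] at hg
  subst hg
  show (1 : ℕ) ≤ 2
  norm_num

/-- If the output wire of `C` is the input `i`, then `C` computes the projection `x ↦ x i`.
[cite: AroraBarak2009, Def. 6.1] -/
theorem eval_of_output_inl (C : Circuit ι) {i : ι} (hi : C.output = .inl i) (x : ι → Bool) :
    C.eval x = x i := by
  rw [eval_eq_wireVal, hi]
  rfl

end Circuit

/-- **XOR-shift invariance of `B₂` circuit size.** If some `B₂` circuit computes `f`, then for every
shift `a` the translate `x ↦ f(x ⊕ a)` has `B₂`-complexity `≤ max(C_{B₂}(f), 1)`: absorb the shift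
into the gates of an optimal circuit; if the optimal circuit is a bare input wire `x_k` the translate
is `x_k` or `¬x_k`. [cite: Jukna2012, §1.2 (B₂ = all gates of fan-in ≤ 2; input negations absorbed into gates)] -/
theorem circuitSizeOver_B2_compXor_le (f : (ι → Bool) → Bool) (a : ι → Bool)
    (hf : ∃ C : Circuit ι, C.IsOver B2 ∧ C.Computes f) :
    circuitSizeOver B2 (fun x => f fun i => xor (x i) (a i)) ≤ max (circuitSizeOver B2 f) 1 := by
  obtain ⟨C, hB, hC, hsize⟩ := exists_circuit_size_eq_circuitSizeOver hf
  cases hout : C.output with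
  | inr m =>
    refine (circuitSizeOver_le_of_computes (C.xorInputs a) (C.isOver_B2_xorInputs hB a)
      fun x => ?_).trans ?_
    · rw [C.eval_xorInputs a hout]
      exact hC _
    · rw [Circuit.size_xorInputs, hsize]
      exact le_max_left _ _
  | inl k =>
    have hfk : ∀ x, f x = x k := fun x => (hC x).symm.trans (C.eval_of_output_inl hout x)
    cases hak : a k with
    | false =>
      have : (fun x : ι → Bool => f fun i => xor (x i) (a i)) = f := by
        funext x
        rw [hfk, hfk, hak, Bool.xor_false]
      rw [this]
      exact le_max_left _ _
    | true =>
      refine (circuitSizeOver_le_of_computes (Circuit.notInput k) (Circuit.isOver_B2_notInput k)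
        fun x => ?_).trans (le_max_right _ _)
      rw [Circuit.eval_notInput, hfk, hak, Bool.xor_true]

end XorShift

/-! ### All coordinates sensitive: deterministic and probabilistic reading bounds -/

variable {N : ℕ}

/-- A single-bit flip is a `Function.update`. [cite: Nisan1991, §1 (sensitivity to a coordinate)] -/
theorem flipBlock_singleton_eq_update (x : Fin N → Bool) (i : Fin N) :
    flipBlock x {i} = Function.update x i (!x i) := by
  funext j
  rcases eq_or_ne j i with rfl | h
  · rw [flipBlock_apply_of_mem (Finset.mem_singleton_self j), Function.update_self]
  · rw [flipBlock_apply_of_not_mem (by simpa using h), Function.update_of_ne h]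

/-- A nonconstant Boolean function on the cube has a sensitive coordinate somewhere: on any flip
path from `x` to `y` with `f x ≠ f y` some single flip changes the value.
[cite: Nisan1991, §1 (sensitivity to a coordinate)] -/
theorem exists_flip_ne_of_ne {f : (Fin N → Bool) → Bool} {x y : Fin N → Bool} (h : f x ≠ f y) :
    ∃ (i : Fin N) (z : Fin N → Bool), f (flipBlock z {i}) ≠ f z := by
  by_contra hcon
  push Not at hcon
  have := apply_flipBlock_eq_of_subset (I := Finset.univ) (fun i _ z => hcon i z) x (diffSet x y)
    (Finset.subset_univ _)
  rw [flipBlock_diffSet] at this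
  exact h this.symm

/-- **A `B₂` circuit computing a function sensitive at every coordinate reads all of them, so has
`≥ N − 1` gates** (Hirsch–Melanich–Nikolenko 2012, Prop. 8.1, after Lamagna–Savage; here: every
coordinate lies in the light cone, `Circuit.eval_congr_lightCone`, and a `B₂` circuit with `s` gates
has a light cone of size `≤ s + 1`, `Circuit.card_lightCone_le_size_succ`).
[cite: HirschMelanichNikolenko2012, Prop. 8.1] -/
theorem Circuit.le_size_succ_of_forall_sensitive (C : Circuit (Fin N)) (hC : C.IsOver B2)
    {f : (Fin N → Bool) → Bool} (hf : C.Computes f)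
    (hsens : ∀ i : Fin N, ∃ x, f (flipBlock x {i}) ≠ f x) : N ≤ C.size + 1 := by
  classical
  have hcone : C.lightCone = Finset.univ := by
    refine Finset.eq_univ_of_forall fun i => ?_
    by_contra hi
    obtain ⟨x, hx⟩ := hsens i
    refine hx ?_
    rw [← hf, ← hf]
    exact C.eval_congr_lightCone fun j hj => by
      have hji : j ≠ i := by
        rintro rfl
        exact hi hj
      exact flipBlock_apply_of_not_mem (by simpa using hji)
  have := C.card_lightCone_le_size_succ hC
  rwa [hcone, Finset.card_univ, Fintype.card_fin] at this

/-- **Probabilistic form: `N − (s + 1) ≤ 2ε·N`** for any distribution `μ` of `B₂` circuits with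
`≤ s` gates computing, with error `≤ ε` on every input, a function sensitive at every one of its `N`
coordinates (`PMF.card_sub_le_sum_toOuterMeasure_not_mem_lightCone` with `J = univ` and
`PMF.toOuterMeasure_not_mem_lightCone_le` at every coordinate). [cite: Nisan1991, Thm. (bs ≤ 3R)] -/
theorem PMF.card_sub_le_of_forall_sensitive (μ : PMF (Circuit (Fin N))) {s : ℕ} {ε : ℝ≥0∞}
    (hμ : ∀ C ∈ μ.support, C.IsOver B2 ∧ C.size ≤ s) {f : (Fin N → Bool) → Bool}
    (herr : ∀ x, μ.toOuterMeasure {C | C.eval x ≠ f x} ≤ ε)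
    (hsens : ∀ i : Fin N, ∃ x, f (flipBlock x {i}) ≠ f x) :
    ((N - (s + 1) : ℕ) : ℝ≥0∞) ≤ 2 * ε * N := by
  classical
  calc ((N - (s + 1) : ℕ) : ℝ≥0∞)
      = (((Finset.univ : Finset (Fin N)).card - (s + 1) : ℕ) : ℝ≥0∞) := by
        rw [Finset.card_univ, Fintype.card_fin]
    _ ≤ ∑ i ∈ (Finset.univ : Finset (Fin N)), μ.toOuterMeasure {C | i ∉ C.lightCone} :=
        PMF.card_sub_le_sum_toOuterMeasure_not_mem_lightCone μ hμ _
    _ ≤ ∑ _i ∈ (Finset.univ : Finset (Fin N)), 2 * ε :=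
        Finset.sum_le_sum fun i _ => by
          obtain ⟨x, hx⟩ := hsens i
          exact PMF.toOuterMeasure_not_mem_lightCone_le μ herr hx
    _ = 2 * ε * N := by
        rw [Finset.sum_const, Finset.card_univ, Fintype.card_fin, nsmul_eq_mul, mul_comm]

end Literature.Computability.Complexity

namespace Literature.Computability.MetaComplexity

open Filter Finset Literature.Computability.Complexity
open scoped ENNReal

/-! ### Translation invariance of `MCSP[θ]` (`θ ≥ 1`) -/

variable {n : ℕ}

/-- The translate `v ↦ g(v ⊕ a)` of an `n`-variable Boolean function has `B₂`-complexity
`≤ max(C(g), 1)`. [cite: Jukna2012, §1.2 (B₂ = all gates of fan-in ≤ 2; input negations absorbed into gates)] -/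
theorem circuitSizeOver_compXor_le (g : (Fin n → Bool) → Bool) (a : Fin n → Bool) :
    circuitSizeOver B2 (fun v => g fun j => xor (v j) (a j)) ≤ max (circuitSizeOver B2 g) 1 :=
  circuitSizeOver_B2_compXor_le g a (exists_computes_B2_holds g)

/-- Translating twice by the same shift is the identity. [cite: Jukna2012, §1.2 (B₂ = all gates of fan-in ≤ 2; input negations absorbed into gates)] -/
theorem compXor_compXor (g : (Fin n → Bool) → Bool) (a : Fin n → Bool) :
    (fun v : Fin n → Bool => (fun w : Fin n → Bool => g fun j => xor (w j) (a j))
      fun j => xor (v j) (a j)) = g := by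
  funext v
  simp only [Bool.xor_assoc, Bool.xor_self, Bool.xor_false]

/-- **`MCSP[θ]` is translation invariant for `θ n ≥ 1`**: `tt(g) ∈ MCSP[θ] ↔ tt(g ∘ τ_a) ∈ MCSP[θ]`.
[cite: Jukna2012, §1.2 (B₂ = all gates of fan-in ≤ 2; input negations absorbed into gates)] -/
theorem truthTable_compXor_mem_MCSPSize_iff {θ : ℕ → ℕ} (hθ : 1 ≤ θ n)
    (g : (Fin n → Bool) → Bool) (a : Fin n → Bool) :
    truthTable (fun v => g fun j => xor (v j) (a j)) ∈ MCSPSize θ ↔ truthTable g ∈ MCSPSize θ := by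
  simp only [truthTable_mem_MCSPSize_iff]
  refine ⟨fun h => ?_, fun h => (circuitSizeOver_compXor_le g a).trans (max_le h hθ)⟩
  have := (circuitSizeOver_compXor_le (fun w => g fun j => xor (w j) (a j)) a).trans (max_le h hθ)
  rwa [compXor_compXor] at this

/-! ### Every position of the truth table is a sensitive coordinate of `MCSP[θ]` -/

/-- The translation `τ_a : w ↦ w ⊕ a` is injective. [cite: Jukna2012, §1.2 (B₂ = all gates of fan-in ≤ 2; input negations absorbed into gates)] -/
theorem xorShift_injective (a : Fin n → Bool) :
    Function.Injective fun w : Fin n → Bool => fun j => xor (w j) (a j) := by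
  intro w w' h
  funext j
  have := congrFun h j
  simpa using this

/-- Equal membership gives equal indicator bits. [folklore] -/
private theorem boolIndicator_congr {α : Type*} (L : Set α) {u w : α} (h : u ∈ L ↔ w ∈ L) :
    L.boolIndicator u = L.boolIndicator w := by
  classical
  simp only [Set.boolIndicator, h]

/-- **`MCSP[θ]` is sensitive at every position.** If `θ n ≥ 1` and the slice
`MCSP[θ] ∩ {0,1}^{2ⁿ}` is a proper nonempty subset (witnessed by two tables with different
membership bits), then for EVERY position `i < 2ⁿ` some table changes membership when bit `i` is
flipped: a sensitive position exists (`exists_flip_ne_of_ne`) and the translations of `{0,1}ⁿ`,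
which preserve membership (`truthTable_compXor_mem_MCSPSize_iff`) and commute with flips, act
transitively on positions. [cite: HirschMelanichNikolenko2012, Prop. 8.1 (its hypothesis — f depends non-idly on every variable — established for MCSP[θ])] -/
theorem MCSPSize_sensitive_everywhere {θ : ℕ → ℕ} (hθ : 1 ≤ θ n)
    (hne : ∃ x y : Fin (2 ^ n) → Bool,
      (MCSPSize θ).boolIndicator (List.ofFn x) ≠ (MCSPSize θ).boolIndicator (List.ofFn y))
    (i : Fin (2 ^ n)) :
    ∃ x : Fin (2 ^ n) → Bool,
      (MCSPSize θ).boolIndicator (List.ofFn (flipBlock x {i})) ≠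
        (MCSPSize θ).boolIndicator (List.ofFn x) := by
  classical
  -- notation: `F` the membership bit, `e` positions ↔ points, `T g` the table of `g`
  set F : (Fin (2 ^ n) → Bool) → Bool := fun x => (MCSPSize θ).boolIndicator (List.ofFn x) with hF
  set e := boolFunEquivFin n with he
  have hT : ∀ g : (Fin n → Bool) → Bool, F (g ∘ e.symm) = (MCSPSize θ).boolIndicator (truthTable g) :=
    fun g => rfl
  -- a sensitive position `i₀` with witness `x₀`
  obtain ⟨x, y, hxy⟩ := hne
  obtain ⟨i₀, x₀, hx₀⟩ := exists_flip_ne_of_ne (f := F) hxy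
  -- translate it to `i`
  set v₀ : Fin n → Bool := e.symm i₀ with hv₀
  set v : Fin n → Bool := e.symm i with hv
  set a : Fin n → Bool := fun k => xor (v k) (v₀ k) with ha
  set τ : (Fin n → Bool) → (Fin n → Bool) := fun w j => xor (w j) (a j) with hτ
  have hτv : τ v = v₀ := by
    funext k
    simp only [hτ, ha, ← Bool.xor_assoc, Bool.xor_self, Bool.false_xor]
  set g₀ : (Fin n → Bool) → Bool := x₀ ∘ e with hg₀
  have hx₀g : g₀ ∘ e.symm = x₀ := by
    funext j
    simp [hg₀]
  set g' : (Fin n → Bool) → Bool := g₀ ∘ τ with hg'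
  refine ⟨g' ∘ e.symm, ?_⟩
  -- membership is translation invariant
  have hinv : ∀ g : (Fin n → Bool) → Bool, F ((g ∘ τ) ∘ e.symm) = F (g ∘ e.symm) := fun g => by
    rw [hT, hT]
    exact boolIndicator_congr _ (truthTable_compXor_mem_MCSPSize_iff hθ g a)
  -- the flip at `i` of the translated table is the translate of the flip at `i₀`
  set c : Bool := !(g' ∘ e.symm) i with hc
  have hci₀ : c = !x₀ i₀ := by
    simp only [hc, Function.comp_apply, hg', ← hv, hτv, hg₀, hv₀, Equiv.apply_symm_apply]
  have hflip : flipBlock (g' ∘ e.symm) {i} = (Function.update g₀ v₀ c ∘ τ) ∘ e.symm := by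
    rw [flipBlock_singleton_eq_update, ← hc]
    rw [show Function.update (g' ∘ ⇑e.symm) i c = Function.update g' (e.symm i) c ∘ e.symm from
      (Function.update_comp_eq_of_injective g' e.symm.injective i c).symm, ← hv]
    rw [hg', show Function.update (g₀ ∘ τ) v c = Function.update g₀ (τ v) c ∘ τ from
      (Function.update_comp_eq_of_injective g₀ (xorShift_injective a) v c).symm, hτv]
  have hflip₀ : flipBlock x₀ {i₀} = Function.update g₀ v₀ c ∘ e.symm := by
    rw [flipBlock_singleton_eq_update, ← hci₀, ← hx₀g, hv₀]
    exact (Function.update_comp_eq_of_injective g₀ e.symm.injective i₀ c).symm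
  -- conclude
  change F (flipBlock (g' ∘ e.symm) {i}) ≠ F (g' ∘ e.symm)
  rw [hflip, hinv, hg', hinv, ← hflip₀, hx₀g]
  exact hx₀

/-! ### NO instances from the circuit count -/

/-- If fewer than `2^{2ⁿ}` functions have complexity `≤ t` (the tree's count), some `n`-variable
function has complexity `> t`. [cite: AroraBarak2009, Thm. 6.21 (counting)] -/
theorem exists_lt_circuitSizeOver_of_count_lt {t : ℕ}
    (h : (t + 1) * (16 * (n + t + 1) ^ 2) ^ t * (n + t + 1) < 2 ^ 2 ^ n) :
    ∃ g : (Fin n → Bool) → Bool, t < circuitSizeOver B2 g := by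
  classical
  by_contra hcon
  push Not at hcon
  have huniv : (Finset.univ.filter fun g : (Fin n → Bool) → Bool => circuitSizeOver B2 g ≤ t) =
      Finset.univ := Finset.filter_true_of_mem fun g _ => hcon g
  have := card_filter_circuitSizeOver_le n t
  rw [huniv, Finset.card_univ, Fintype.card_fun, Fintype.card_bool, Fintype.card_fun,
    Fintype.card_bool, Fintype.card_fin] at this
  exact absurd (this.trans_lt h) (lt_irrefl _)

/-- For `0 ≤ β < 1`, eventually some `n`-variable function has complexity `> ⌈2^{βn}⌉`
(`eventually_circuitCount_noBound_lt`). [cite: AroraBarak2009, Thm. 6.21 (counting)] -/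
theorem eventually_exists_noBound_lt_circuitSizeOver {β : ℝ} (hβ : 0 ≤ β) (hβ1 : β < 1) :
    ∀ᶠ n : ℕ in atTop, ∃ g : (Fin n → Bool) → Bool,
      OliveiraPichSanthanam2019.noBound β n < circuitSizeOver B2 g := by
  obtain ⟨hββ', hβ'1⟩ : β < (β + 1) / 2 ∧ (β + 1) / 2 < 1 := ⟨by linarith, by linarith⟩
  filter_upwards [eventually_circuitCount_noBound_lt hβ hββ' hβ'1] with n hn
  exact exists_lt_circuitSizeOver_of_count_lt
    (hn.trans_le (Nat.pow_le_pow_right two_pos ((Nat.sub_le _ _).trans (Nat.sub_le _ _))))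

/-- The two membership bits of `MCSP[θ]` at length `2ⁿ` are both taken as soon as `1 ≤ θ n` (the
constant function is a YES instance) and some function has complexity `> θ n`.
[cite: AroraBarak2009, Thm. 6.21 (counting: hard functions exist)] -/
theorem MCSPSize_exists_boolIndicator_ne {θ : ℕ → ℕ} (hθ : 1 ≤ θ n)
    (hno : ∃ g : (Fin n → Bool) → Bool, θ n < circuitSizeOver B2 g) :
    ∃ x y : Fin (2 ^ n) → Bool,
      (MCSPSize θ).boolIndicator (List.ofFn x) ≠ (MCSPSize θ).boolIndicator (List.ofFn y) := by
  classical
  obtain ⟨g, hg⟩ := hno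
  set e := boolFunEquivFin n
  refine ⟨(fun _ => false) ∘ e.symm, g ∘ e.symm, ?_⟩
  have hyes : List.ofFn ((fun _ : Fin n → Bool => false) ∘ ⇑e.symm) ∈ MCSPSize θ := by
    rw [show List.ofFn ((fun _ : Fin n → Bool => false) ∘ ⇑e.symm) =
        truthTable (fun _ : Fin n → Bool => false) from rfl, truthTable_mem_MCSPSize_iff]
    refine (circuitSizeOver_le_of_computes (B := B2) (Circuit.const (Fin n) false) ?_
      fun x => Circuit.eval_const false x).trans (by simpa using hθ)
    intro g' hg'
    simp only [Circuit.const, List.mem_singleton] at hg'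
    subst hg'
    show (0 : ℕ) ≤ 2
    norm_num
  have hno' : List.ofFn (g ∘ ⇑e.symm) ∉ MCSPSize θ := by
    rw [show List.ofFn (g ∘ ⇑e.symm) = truthTable g from rfl, truthTable_mem_MCSPSize_iff]
    exact not_le.2 hg
  rw [(Set.mem_iff_boolIndicator _ _).1 hyes]
  intro h
  exact hno' ((Set.mem_iff_boolIndicator _ _).2 h.symm)

/-! ### Family forms -/

/-- **`MCSP[θ] ∉ SIZEae s` whenever infinitely often `1 ≤ θ n`, some function has complexity
`> θ n`, and `s(2ⁿ) + 2 ≤ 2ⁿ`**: at such a length the family's circuit computes a function sensitive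
at all `N = 2ⁿ` positions, so has `≥ N − 1` gates. [cite: HirschMelanichNikolenko2012, Prop. 8.1] -/
theorem MCSPSize_not_mem_SIZEae_of_sensitive {θ s : ℕ → ℕ}
    (h : ∃ᶠ n : ℕ in atTop, 1 ≤ θ n ∧ (∃ g : (Fin n → Bool) → Bool, θ n < circuitSizeOver B2 g) ∧
      s (2 ^ n) + 2 ≤ 2 ^ n) :
    MCSPSize θ ∉ SIZEae s := by
  classical
  rintro ⟨C, ⟨n₀, hn₀⟩, hCL⟩
  obtain ⟨n, hn₁, hθ, hno, hs⟩ := frequently_atTop.1 h n₀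
  have hn0 : n₀ ≤ 2 ^ n := hn₁.trans n.lt_two_pow_self.le
  obtain ⟨hB, hsize⟩ := hn₀ _ hn0
  have hcomp : (C (2 ^ n)).Computes fun x => (MCSPSize θ).boolIndicator (List.ofFn x) :=
    fun x => hCL.eval_eq x
  have hsens := MCSPSize_sensitive_everywhere hθ (MCSPSize_exists_boolIndicator_ne hθ hno)
  have := (C (2 ^ n)).le_size_succ_of_forall_sensitive hB hcomp hsens
  omega

/-- **`MCSP[θ] ∉ PSIZEae ε s` whenever infinitely often `1 ≤ θ n`, some function has complexity
`> θ n`, and `2·ε(N)·N < N − (s(N) + 1)`** (`N = 2ⁿ`; `PMF.card_sub_le_of_forall_sensitive`).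
[cite: ChenLiYang2022, Thm. 1.6 (known column), §2.2 (probabilistic B₂ circuits)] -/
theorem MCSPSize_not_mem_PSIZEae_of_sensitive {θ s : ℕ → ℕ} {ε : ℕ → ℝ≥0∞}
    (h : ∃ᶠ n : ℕ in atTop, 1 ≤ θ n ∧ (∃ g : (Fin n → Bool) → Bool, θ n < circuitSizeOver B2 g) ∧
      2 * ε (2 ^ n) * ((2 ^ n : ℕ) : ℝ≥0∞) < ((2 ^ n - (s (2 ^ n) + 1) : ℕ) : ℝ≥0∞)) :
    MCSPSize θ ∉ ChenLiYang2022.PSIZEae ε s := by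
  classical
  rintro ⟨F, ⟨n₀, hn₀⟩, hF⟩
  obtain ⟨n, hn₁, hθ, hno, hlt⟩ := frequently_atTop.1 h n₀
  have hn0 : n₀ ≤ 2 ^ n := hn₁.trans n.lt_two_pow_self.le
  set μ : PMF (Circuit (Fin (2 ^ n))) := F (2 ^ n) with hμdef
  have hμ : ∀ C ∈ μ.support, C.IsOver B2 ∧ C.size ≤ s (2 ^ n) := fun C hC => hn₀ _ hn0 C hC
  have herr : ∀ x : Fin (2 ^ n) → Bool,
      μ.toOuterMeasure {C | C.eval x ≠ (MCSPSize θ).boolIndicator (List.ofFn x)} ≤ ε (2 ^ n) :=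
    fun x => PFamilyAE.toOuterMeasure_ofFn_le hF x
  have hsens := MCSPSize_sensitive_everywhere hθ (MCSPSize_exists_boolIndicator_ne hθ hno)
  have key := PMF.card_sub_le_of_forall_sensitive μ hμ herr hsens
  exact absurd (key.trans_eq (by norm_cast)) (not_le.2 hlt)

/-! ### Row R10 cells -/

/-- **Deterministic cell: `MCSP[θ] ∉ SIZEae (N − 2)`** — `N − 1` gates are necessary at infinitely
many lengths — for every `θ` with eventually `1 ≤ θ n ≤ ⌈2^{βn}⌉`, `0 ≤ β < 1` (the row's
`θ = ⌊n^β⌋`, `1 ≤ β < 2`, included). [cite: HirschMelanichNikolenko2012, Prop. 8.1] -/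
theorem MCSPSize_not_mem_SIZEae_sub_two {θ : ℕ → ℕ} {β : ℝ} (hβ : 0 ≤ β) (hβ1 : β < 1)
    (hθ1 : ∀ᶠ n : ℕ in atTop, 1 ≤ θ n)
    (hθ : ∀ᶠ n : ℕ in atTop, θ n ≤ OliveiraPichSanthanam2019.noBound β n) :
    MCSPSize θ ∉ SIZEae fun N => N - 2 := by
  refine MCSPSize_not_mem_SIZEae_of_sensitive (Eventually.frequently ?_)
  filter_upwards [hθ1, hθ, eventually_exists_noBound_lt_circuitSizeOver hβ hβ1,
    eventually_ge_atTop 1] with n h1 hθn hno hn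
  obtain ⟨g, hg⟩ := hno
  refine ⟨h1, ⟨g, hθn.trans_lt hg⟩, ?_⟩
  have : 2 ≤ 2 ^ n := by
    calc 2 = 2 ^ 1 := rfl
      _ ≤ 2 ^ n := Nat.pow_le_pow_right (by norm_num) hn
  omega

/-- **Probabilistic cell, error exponent `c > 1`: `MCSP[θ] ∉ PSIZEae (N^{−c}) (N − 3)`** for every
`θ` with eventually `1 ≤ θ n ≤ ⌈2^{βn}⌉`, `0 ≤ β < 1`: `N − (s + 1) ≤ 2N^{1−c} < 2` forces
`s ≥ N − 2`. [cite: ChenLiYang2022, Thm. 1.6 (known column), §2.2 (probabilistic B₂ circuits)] -/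
theorem MCSPSize_not_mem_PSIZEae_sub_three {θ : ℕ → ℕ} {β : ℝ} (hβ : 0 ≤ β) (hβ1 : β < 1)
    (hθ1 : ∀ᶠ n : ℕ in atTop, 1 ≤ θ n)
    (hθ : ∀ᶠ n : ℕ in atTop, θ n ≤ OliveiraPichSanthanam2019.noBound β n) {c : ℝ} (hc : 1 < c) :
    MCSPSize θ ∉ ChenLiYang2022.PSIZEae (ChenLiYang2022.invPoly c) fun N => N - 3 := by
  refine MCSPSize_not_mem_PSIZEae_of_sensitive (Eventually.frequently ?_)
  filter_upwards [hθ1, hθ, eventually_exists_noBound_lt_circuitSizeOver hβ hβ1,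
    eventually_ge_atTop 2] with n h1 hθn hno hn
  obtain ⟨g, hg⟩ := hno
  refine ⟨h1, ⟨g, hθn.trans_lt hg⟩, ?_⟩
  set N : ℕ := 2 ^ n with hN
  have hN4 : 4 ≤ N := by
    calc 4 = 2 ^ 2 := rfl
      _ ≤ 2 ^ n := Nat.pow_le_pow_right (by norm_num) hn
  have hsub : ((N - (N - 3 + 1) : ℕ) : ℝ≥0∞) = 2 := by
    rw [show N - (N - 3 + 1) = 2 by omega, Nat.cast_ofNat]
  rw [hsub]
  -- `2 · N^{−c} · N = 2 · N^{1−c} < 2`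
  have hNpos : (0 : ℝ) < N := by exact_mod_cast (show 0 < N by omega)
  have hN1 : (1 : ℝ) < N := by exact_mod_cast (show 1 < N by omega)
  have hlt : ((N : ℝ) ^ c)⁻¹ * N < 1 := by
    rw [inv_mul_lt_iff₀ (Real.rpow_pos_of_pos hNpos c), mul_one]
    calc (N : ℝ) = (N : ℝ) ^ (1 : ℝ) := (Real.rpow_one _).symm
      _ < (N : ℝ) ^ c := Real.rpow_lt_rpow_of_exponent_lt hN1 hc
  have h2 : 2 * ((N : ℝ) ^ c)⁻¹ * N < 2 := by nlinarith
  have hinv : ChenLiYang2022.invPoly c N = ENNReal.ofReal (((N : ℝ) ^ c)⁻¹) := rfl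
  have hprod : 2 * ENNReal.ofReal (((N : ℝ) ^ c)⁻¹) * (N : ℝ≥0∞) =
      ENNReal.ofReal (2 * ((N : ℝ) ^ c)⁻¹ * N) := by
    rw [ENNReal.ofReal_mul (by positivity), ENNReal.ofReal_mul (by norm_num : (0 : ℝ) ≤ 2),
      ENNReal.ofReal_natCast, ENNReal.ofReal_ofNat]
  rw [hinv, hprod, show (2 : ℝ≥0∞) = ENNReal.ofReal 2 from (ENNReal.ofReal_ofNat 2).symm]
  exact (ENNReal.ofReal_lt_ofReal_iff two_pos).2 h2

/-- **Probabilistic cell, any error exponent: `MCSP[θ] ∉ PSIZEae (N^{−c}) (N − ⌈N^{β'}⌉)` for every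
`β'` with `max(0, 1 − c) < β' < 1`** and every `θ` with eventually `1 ≤ θ n ≤ ⌈2^{βn}⌉`, `0 ≤ β < 1`
(the companion file's `MCSPSize_not_mem_PSIZEae_sublinear` needs `β < β'` as well).
[cite: ChenLiYang2022, Thm. 1.6 (known column), §2.2 (probabilistic B₂ circuits)] -/
theorem MCSPSize_not_mem_PSIZEae_sublinear' {θ : ℕ → ℕ} {β : ℝ} (hβ : 0 ≤ β) (hβ1 : β < 1)
    (hθ1 : ∀ᶠ n : ℕ in atTop, 1 ≤ θ n)
    (hθ : ∀ᶠ n : ℕ in atTop, θ n ≤ OliveiraPichSanthanam2019.noBound β n) {c β' : ℝ}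
    (hcβ' : 1 - c < β') (hβ'0 : 0 < β') (hβ'1 : β' < 1) :
    MCSPSize θ ∉
      ChenLiYang2022.PSIZEae (ChenLiYang2022.invPoly c) fun N => N - ⌈(N : ℝ) ^ β'⌉₊ := by
  refine MCSPSize_not_mem_PSIZEae_of_sensitive (Eventually.frequently ?_)
  have hβ''β' : β' / 2 < β' := by linarith
  have hbud := (tendsto_pow_atTop_atTop_of_one_lt (one_lt_two : (1 : ℕ) < 2)).eventually
    ((eventually_deficiency_budget hcβ' hβ''β' hβ'0).and (eventually_ge_atTop 1))
  filter_upwards [hθ1, hθ, eventually_exists_noBound_lt_circuitSizeOver hβ hβ1, hbud]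
    with n h1 hθn hno hn
  obtain ⟨g, hg⟩ := hno
  refine ⟨h1, ⟨g, hθn.trans_lt hg⟩, ?_⟩
  obtain ⟨hbud, hN1⟩ := hn
  set N : ℕ := 2 ^ n with hN
  have hN1' : (1 : ℝ) ≤ N := by exact_mod_cast hN1
  have hNpos : (0 : ℝ) < N := by positivity
  -- `⌈N^{β'}⌉ ≤ N`, so the budget is an honest subtraction and `N − (s + 1) = ⌈N^{β'}⌉ − 1`
  have hceil : ⌈(N : ℝ) ^ β'⌉₊ ≤ N := by
    refine Nat.ceil_le.2 ?_
    calc (N : ℝ) ^ β' ≤ (N : ℝ) ^ (1 : ℝ) := Real.rpow_le_rpow_of_exponent_le hN1' hβ'1.le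
      _ = N := Real.rpow_one _
  have hceil1 : 1 ≤ ⌈(N : ℝ) ^ β'⌉₊ := Nat.one_le_ceil_iff.2 (Real.rpow_pos_of_pos hNpos _)
  have hdef : N - (N - ⌈(N : ℝ) ^ β'⌉₊ + 1) = ⌈(N : ℝ) ^ β'⌉₊ - 1 := by omega
  have hpow'' : (0 : ℝ) ≤ (N : ℝ) ^ (β' / 2) := by positivity
  have hceil' : (N : ℝ) ^ β' ≤ ⌈(N : ℝ) ^ β'⌉₊ := Nat.le_ceil _
  -- real inequality `2 N^{-c} N < ⌈N^{β'}⌉ - 1`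
  have hreal : 2 * ((N : ℝ) ^ c)⁻¹ * N < ((⌈(N : ℝ) ^ β'⌉₊ - 1 : ℕ) : ℝ) := by
    rw [Nat.cast_sub hceil1]
    push_cast
    linarith
  have hinv : ChenLiYang2022.invPoly c N = ENNReal.ofReal (((N : ℝ) ^ c)⁻¹) := rfl
  rw [hdef, hinv]
  have hprod : 2 * ENNReal.ofReal (((N : ℝ) ^ c)⁻¹) * (N : ℝ≥0∞) =
      ENNReal.ofReal (2 * ((N : ℝ) ^ c)⁻¹ * N) := by
    rw [ENNReal.ofReal_mul (by positivity), ENNReal.ofReal_mul (by norm_num : (0 : ℝ) ≤ 2),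
      ENNReal.ofReal_natCast, ENNReal.ofReal_ofNat]
  have hpos : (0 : ℝ) < ((⌈(N : ℝ) ^ β'⌉₊ - 1 : ℕ) : ℝ) := lt_of_le_of_lt (by positivity) hreal
  rw [hprod, ← ENNReal.ofReal_natCast]
  exact (ENNReal.ofReal_lt_ofReal_iff hpos).2 hreal

end Literature.Computability.MetaComplexity
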